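import Summits.CriticalPhenomena.PercolationContinuityZ3.Theorems.PercNearOneGluingNoHeavyQuantGatesWidthSeven
import HarnessLib

/-!
# QUANT lane R8, T-DEC: BLOB-AFL for every gate vector of width ≤ 7 — LIST FORM (blob lists with a common size, floor `blobMean/blobTop`)
# (prim-quant-census-2 gen 83, file 8b)

builds on p205010 (kernel theorem, internal audit signed; external expert review pending)

Support file (`--supports stmt-CriticalPhenomena-4575`), QUANT lane census seat prim-quant-census-2 (gen 83); memo
`run/shared/lean/prim/quant/prim-quant-census-2-g83/HOEFFDING-G83.md`.  Theorems only, standard axioms, no sorries, no definitions.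

`heavy_blobLaw_gates_width_le_seven` (`…QuantGatesWidthSeven`) is stated for a gate list `G` and a blob size `k` (`blobLaw (G.map (k,·))`, floor
`ΣG/|G|`, target `k·ΣG`).  The glued-sibling consumers (census-2 g80's width-generic SDEC scheme, `heavy_blobLaw_of_mean_le_two`,
`heavy_blobLaw_of_half_le_gates`) speak of a blob LIST `l` with all sizes `= k`, floor `blobMean l / blobTop l`, target `blobMean l`:
* **`heavy_blobLaw_of_gates_width_le_seven`** — `l` with all sizes `= k ≥ 1`, gates in `[0,1]`, `|l| ≤ 7` ⟹ `blobLaw l` heavy at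
  `(blobMean l / blobTop l, blobMean l)` on `{0..blobTop l}`; `decAtT_blobLaw_of_gates_width_le_seven`.

HONEST STATUS.  Repackaging only; width `≥ 8` for arbitrary gates in flight / OPEN; conjecture C, `SiblingStep`, `FarTreeRow`, `GluedLemmaW`,
`GluedDominatedMass` OPEN; RATE class (log\*) / honest sentence of `run/shared/lean/prim/quant/README.md` unchanged.  [this work].  Nothing here is
cited as a published result.  The gluing rows served [cite: KozmaNitzan2024, Conjecture 3 (p. 15)]; product measure [cite: Grimmett1999, §1.3 p. 10].
-/

noncomputable section

open scoped BigOperators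

namespace Summit.CriticalPhenomena.PercolationContinuityZ3.Theorems
namespace Quant

open Finset

/-- the two-point law `{lo, hi; g}` (as in `…QuantLawDEC`) -/
local notation3 "TP[" lo ", " hi ", " g ", " h "]" =>
  (g : ℝ) * (if (h : ℕ) = (hi : ℕ) then (1 : ℝ) else 0) + (1 - (g : ℝ)) * (if (h : ℕ) = (lo : ℕ) then (1 : ℝ) else 0)

/-- a HEAVY decomposition of the law `μ` on `{0..M}` at floor `x`, target `T` (the inline `∃` consumed by `decAtT_of_heavy`) -/
local notation3 "HEAVY[" x ", " T ", " M ", " μ "]" =>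
  ∃ (ι : Type) (_ : Fintype ι) (lam γ : ι → ℝ) (lo hi : ι → ℕ),
    (∀ i, 0 ≤ lam i) ∧ (∑ i, lam i = 1) ∧ (∀ i, 0 ≤ γ i ∧ γ i ≤ 1) ∧ (∀ i, lo i ≤ hi i) ∧ (∀ i, hi i ≤ (M : ℕ)) ∧
    (∀ h, (μ : ℕ → ℝ) h = ∑ i, lam i * TP[lo i, hi i, γ i, h]) ∧
    (∀ i, 0 < lam i → (x : ℝ) ≤ γ i ∧ (T : ℝ) ≤ 2 * (lo i : ℝ) + ((hi i : ℝ) - lo i) * γ i)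

namespace LawDec

/-- **LIST FORM**: a blob list with all sizes `= k ≥ 1`, gates in `[0,1]` and at most `7` blobs is heavy at floor `blobMean l / blobTop l` (its AVERAGE
gate) and target `blobMean l`. [this work] -/
theorem heavy_blobLaw_of_gates_width_le_seven (k : ℕ) (hk : 0 < k) (l : List (ℕ × ℝ))
    (hl : ∀ p ∈ l, p.1 = k ∧ 0 ≤ p.2 ∧ p.2 ≤ 1) (hn : l.length ≤ 7) :
    HEAVY[blobMean l / blobTop l, blobMean l, blobTop l, blobLaw l] := by
  obtain ⟨G, hG, rfl⟩ : ∃ G : List ℝ, (∀ g ∈ G, 0 ≤ g ∧ g ≤ 1) ∧ l = List.map (fun g : ℝ => (k, g)) G := by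
    refine ⟨l.map Prod.snd, fun g hg => ?_, eq_map_blobs_of_sizes k l fun p hp => (hl p hp).1⟩
    obtain ⟨p, hp, rfl⟩ := List.mem_map.1 hg
    exact (hl p hp).2
  rw [blobTop_blobs, blobMean_blobs]
  have hn' : G.length ≤ 7 := by simpa using hn
  have key := heavy_blobLaw_gates_width_le_seven k hk G hG hn'
  rcases Nat.eq_zero_or_pos G.length with h0 | hpos
  · have hGnil : G = [] := List.eq_nil_of_length_eq_zero h0
    subst hGnil
    simpa using key
  · have hk' : (k : ℝ) ≠ 0 := by exact_mod_cast hk.ne'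
    have hn0 : (G.length : ℝ) ≠ 0 := by exact_mod_cast hpos.ne'
    have e : (k : ℝ) * G.sum / ((G.length * k : ℕ) : ℝ) = G.sum / G.length := by
      push_cast; field_simp
    rw [e]
    exact key

/-- **hence DEC at every layer**, list form. [this work] -/
theorem decAtT_blobLaw_of_gates_width_le_seven (k : ℕ) (hk : 0 < k) (l : List (ℕ × ℝ))
    (hl : ∀ p ∈ l, p.1 = k ∧ 0 ≤ p.2 ∧ p.2 ≤ 1) (hn : l.length ≤ 7) (j : ℕ) :
    DECAtT (blobMean l / blobTop l) (blobMean l) j (blobTop l) (blobLaw l) :=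
  decAtT_of_heavy _ _ _ _ (heavy_blobLaw_of_gates_width_le_seven k hk l hl hn) j

end LawDec
end Quant
end Summit.CriticalPhenomena.PercolationContinuityZ3.Theorems
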